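import Mathlib.Analysis.CStarAlgebra.Matrix
import Literature.MathematicalPhysics.QuantumFieldTheory.LatticeGaugeDobrushinPoincare
import HarnessLib

/-!
# A Parseval frame of `𝔰𝔲(N)` and its Casimir identities

First file of the proof of the one-link Poincaré inequality on `SU(N)` (the hypothesis `hLP` of
`shen_zhu_zhu_of_haarPoincare`, `LatticeGaugeDobrushinPoincare.lean`), i.e. of the Bakry–Émery
spectral gap `Var_{ν_B}(ψ) ≤ Lip(ψ)² / (N (1/2 - ‖B‖_op))` for the Gibbs-tilted Haar measures
`ν_B ∝ exp(N Re tr(g B)) dg` on `SU(N)` (Shen–Zhu–Zhu, CMP 400 (2023), Lemma 4.1, (4.7)–(4.8),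
Cor. 4.4 (4.11); numbers of arXiv:2204.12737v1).

We fix an explicit finite family `Y_α ∈ 𝔰𝔲(N)`, `α ∈ (Fin N × Fin N) ⊕ (Fin N × Fin N)`,
`Y_{(j,k)}^A = (E_{jk} - E_{kj})/2`, `Y_{(j,k)}^B = i (E_{jk} + E_{kj})/2 - (i δ_{jk}/N) 1`, which is a
*Parseval frame* of `𝔰𝔲(N)` for the Hilbert–Schmidt inner product `⟨X, Y⟩ = Re tr(Xᴴ Y)`:
`∑_α Y_α[a,b] Y_α[c,d] = -δ_{ad} δ_{bc} + δ_{ab} δ_{cd} / N` (the completeness relation of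
`𝔰𝔲(N)`). All sums over an orthonormal basis of `𝔰𝔲(N)` that occur in the Bakry–Émery
computation (carré du champ, Laplacian, Ricci curvature `Ric = N/2`, i.e. the Killing form) are
therefore sums over this frame, and reduce to the two matrix identities
`∑_α tr(Y_α X) Y_α = -X + (tr X / N) 1` (`SUNBakryEmery.sum_trace_mul_smul_frame`) and
`∑_α Y_α X Y_α = -(tr X) 1 + X / N` (`SUNBakryEmery.sum_frame_mul_mul_frame`), from which we derive
the Parseval identity `∑_α ⟨Y_α, X⟩² = ‖X‖_F²` on `𝔰𝔲(N)` (`sum_sq_re_trace_frame_mul`), the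
Killing form `∑_α ‖[Z, Y_α]‖_F² = 2N ‖Z‖_F²` (`sum_frobNorm_sq_comm_frame`, i.e. `Ric = N/2`,
Shen–Zhu–Zhu (4.8)) and the frame bound `∑_α λ(Y_α)² ≤ M²` for functionals with
`|λ(A)| ≤ M ‖A‖_F` (`sum_sq_apply_frame_le`).

## References

* H. Shen, R. Zhu, X. Zhu, *A stochastic analysis approach to lattice Yang–Mills at strong
  coupling*, CMP 400 (2023) 805–851, arXiv:2204.12737 (numbers and pages of arXiv v1): §2
  (2.3)–(2.4) (Hilbert–Schmidt metric, p. 10) and §4.1, (4.8) (Ricci curvature of `SU(N)`,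
  `Ric(X,X) = (N/2)|X|²`, after [AGZ10, (F.6)], p. 19; Lemma 4.1, p. 17).
* G. W. Anderson, A. Guionnet, O. Zeitouni, *An Introduction to Random Matrices*, CUP (2010),
  Appendix F, (F.6).
-/

noncomputable section

open scoped Matrix ComplexConjugate BigOperators
open Matrix Complex Finset

namespace Literature.MathematicalPhysics.QuantumFieldTheory

namespace SUNBakryEmery

variable {N : ℕ}

/-! ### The frame -/

/-- Index set of the frame: pairs `(j,k)` for the antisymmetric directions and pairs `(j,k)` for
the symmetric ones. [folklore] -/
abbrev FrameIdx (N : ℕ) : Type := (Fin N × Fin N) ⊕ (Fin N × Fin N)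

/-- The matrix unit `E_{jk}`. [folklore] -/
abbrev E (j k : Fin N) : Matrix (Fin N) (Fin N) ℂ := Matrix.single j k 1

/-- Antisymmetric frame directions `(E_{jk} - E_{kj})/2`. [folklore] -/
def frameA (j k : Fin N) : Matrix (Fin N) (Fin N) ℂ := (1 / 2 : ℂ) • (E j k - E k j)

/-- Symmetric directions `i(E_{jk} + E_{kj})/2` of `𝔲(N)` (before removing the trace). [folklore] -/
def frameB0 (j k : Fin N) : Matrix (Fin N) (Fin N) ℂ := (I / 2) • (E j k + E k j)

/-- The central correction `(i δ_{jk} / N) 1`. [folklore] -/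
def frameC (j k : Fin N) : Matrix (Fin N) (Fin N) ℂ := if j = k then (I / N) • (1 : Matrix _ _ ℂ) else 0

/-- Symmetric frame directions `i(E_{jk} + E_{kj})/2 - (i δ_{jk}/N) 1` (traceless). [folklore] -/
def frameB (j k : Fin N) : Matrix (Fin N) (Fin N) ℂ := frameB0 j k - frameC j k

/-- The Parseval frame `(Y_α)` of `𝔰𝔲(N)`. [folklore] -/
def frame : FrameIdx N → Matrix (Fin N) (Fin N) ℂ :=
  Sum.elim (fun p => frameA p.1 p.2) (fun p => frameB p.1 p.2)

/-- Sums over the frame are the two double sums. [folklore] -/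
theorem sum_frame {M : Type*} [AddCommMonoid M] (f : Matrix (Fin N) (Fin N) ℂ → M) :
    ∑ α, f (frame α) = (∑ j, ∑ k, f (frameA j k)) + ∑ j, ∑ k, f (frameB j k) := by
  rw [Fintype.sum_sum_type, Fintype.sum_prod_type, Fintype.sum_prod_type]
  rfl

/-! ### Skew-Hermitian and traceless -/

/-- `E_{jk}ᴴ = E_{kj}`. [folklore] -/
theorem conjTranspose_E (j k : Fin N) : (E j k)ᴴ = E k j := by
  simp [Matrix.conjTranspose_single]

/-- `Y^A` is skew-Hermitian. [folklore] -/
theorem frameA_conjTranspose (j k : Fin N) : (frameA j k)ᴴ = -frameA j k := by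
  rw [frameA, conjTranspose_smul, conjTranspose_sub, conjTranspose_E, conjTranspose_E]
  have : star (1 / 2 : ℂ) = 1 / 2 := by simp
  rw [this, ← smul_neg, neg_sub]

/-- `Y^{B,0}` is skew-Hermitian. [folklore] -/
theorem frameB0_conjTranspose (j k : Fin N) : (frameB0 j k)ᴴ = -frameB0 j k := by
  rw [frameB0, conjTranspose_smul, conjTranspose_add, conjTranspose_E, conjTranspose_E]
  have : star (I / 2) = -(I / 2) := by simp [Complex.conj_I, neg_div]
  rw [this, neg_smul, add_comm]

/-- The central correction is skew-Hermitian. [folklore] -/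
theorem frameC_conjTranspose (j k : Fin N) : (frameC j k)ᴴ = -frameC j k := by
  unfold frameC
  split_ifs
  · rw [conjTranspose_smul, conjTranspose_one]
    have : star (I / N) = -(I / N) := by simp [Complex.conj_I, neg_div]
    rw [this, neg_smul]
  · simp

/-- `Y^B` is skew-Hermitian. [folklore] -/
theorem frameB_conjTranspose (j k : Fin N) : (frameB j k)ᴴ = -frameB j k := by
  rw [frameB, conjTranspose_sub, frameB0_conjTranspose, frameC_conjTranspose]; abel

/-- Every frame direction is skew-Hermitian. [folklore] -/
theorem frame_conjTranspose (α : FrameIdx N) : (frame α)ᴴ = -frame α := by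
  rcases α with ⟨j, k⟩ | ⟨j, k⟩
  · exact frameA_conjTranspose j k
  · exact frameB_conjTranspose j k

/-- `tr E_{jk} = δ_{jk}`. [folklore] -/
theorem trace_E (j k : Fin N) : (E j k).trace = if j = k then 1 else 0 := by
  split_ifs with h
  · subst h; exact trace_single_eq_same j 1
  · exact trace_single_eq_of_ne j k 1 h

/-- `Y^A` is traceless. [folklore] -/
theorem frameA_trace (j k : Fin N) : (frameA j k).trace = 0 := by
  rw [frameA, trace_smul, trace_sub, trace_E, trace_E]
  by_cases h : j = k
  · subst h; simp
  · simp [h, Ne.symm h]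

/-- `Y^B` is traceless. [folklore] -/
theorem frameB_trace (hN : N ≠ 0) (j k : Fin N) : (frameB j k).trace = 0 := by
  rw [frameB, trace_sub, frameB0, trace_smul, trace_add, trace_E, trace_E, frameC]
  by_cases h : j = k
  · subst h
    simp only [if_true, trace_smul, trace_one, Fintype.card_fin, smul_eq_mul]
    field_simp
    ring
  · simp [h, Ne.symm h]

/-- Every frame direction is traceless. [folklore] -/
theorem frame_trace (hN : N ≠ 0) (α : FrameIdx N) : (frame α).trace = 0 := by
  rcases α with ⟨j, k⟩ | ⟨j, k⟩
  · exact frameA_trace j k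
  · exact frameB_trace hN j k

/-! ### Sums of matrix units -/

/-- `∑_{jk} f j k • E_{jk}` is the matrix with entries `f`. [folklore] -/
theorem sum_sum_smul_E (f : Fin N → Fin N → ℂ) : ∑ j, ∑ k, f j k • E j k = Matrix.of f := by
  rw [← sum_sum_single f]
  refine sum_congr rfl fun j _ => sum_congr rfl fun k _ => ?_
  rw [smul_single, smul_eq_mul, mul_one]

/-- `∑_{jk} f j k • E_{kj}` is the transpose of the matrix with entries `f`. [folklore] -/
theorem sum_sum_smul_E' (f : Fin N → Fin N → ℂ) : ∑ j, ∑ k, f j k • E k j = (Matrix.of f)ᵀ := by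
  rw [sum_comm, sum_sum_smul_E fun k j => f j k]
  rfl

/-- `∑_j E_{jj} = 1`. [folklore] -/
theorem sum_E_diag : ∑ j : Fin N, E j j = (1 : Matrix (Fin N) (Fin N) ℂ) := sum_single_one

/-- `tr(E_{jk} X) = X_{kj}`. [folklore] -/
theorem trace_E_mul (j k : Fin N) (X : Matrix (Fin N) (Fin N) ℂ) : (E j k * X).trace = X k j := by
  rw [trace_single_mul, smul_eq_mul, one_mul]

/-- `E_{jk} X E_{j'k'} = X_{kj'} E_{jk'}`. [folklore] -/
theorem E_mul_mul_E (j k j' k' : Fin N) (X : Matrix (Fin N) (Fin N) ℂ) :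
    E j k * X * E j' k' = X k j' • E j k' := by
  rw [single_mul_mul_single, one_mul, mul_one, smul_single, smul_eq_mul, mul_one]

/-- The diagonal part of a matrix. [folklore] -/
theorem sum_diag_smul_E (X : Matrix (Fin N) (Fin N) ℂ) :
    ∑ j, X j j • E j j = diagonal X.diag := by
  rw [← sum_single_eq_diagonal]
  refine sum_congr rfl fun j _ => ?_
  rw [smul_single, smul_eq_mul, mul_one]; rfl

/-- `∑_{jk} (c g(k)) • E_{jj} = (c ∑ g) 1`. [folklore] -/
theorem sum_sum_smul_E_diag_left (c : ℂ) (g : Fin N → ℂ) :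
    ∑ j : Fin N, ∑ k : Fin N, (c * g k) • E j j = (c * ∑ k, g k) • (1 : Matrix (Fin N) (Fin N) ℂ) := by
  simp_rw [← sum_smul]
  rw [← smul_sum, sum_E_diag, mul_sum]

/-- `∑_{jk} (c g(j)) • E_{kk} = (c ∑ g) 1`. [folklore] -/
theorem sum_sum_smul_E_diag_right (c : ℂ) (g : Fin N → ℂ) :
    ∑ j : Fin N, ∑ k : Fin N, (c * g j) • E k k = (c * ∑ j, g j) • (1 : Matrix (Fin N) (Fin N) ℂ) := by
  simp_rw [← smul_sum, sum_E_diag]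
  rw [← sum_smul, mul_sum]

/-- `(i/2) s (i/2) = -s/4`. [folklore] -/
theorem I_half_mul_mul_I_half (s : ℂ) : I / 2 * s * (I / 2) = -(1 / 4) * s := by
  rw [show I / 2 * s * (I / 2) = (I * I) * s / 4 by ring, I_mul_I]; ring

/-! ### The reconstruction identity `∑_α tr(Y_α X) Y_α = -X + (tr X / N) 1` -/

/-- `∑_{jk} tr(Y^A_{jk} X) Y^A_{jk} = (Xᵀ - X)/2`. [folklore] -/
theorem sum_trace_mul_smul_frameA (X : Matrix (Fin N) (Fin N) ℂ) :
    ∑ j, ∑ k, (frameA j k * X).trace • frameA j k = (1 / 2 : ℂ) • (Xᵀ - X) := by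
  have h : ∀ j k, (frameA j k * X).trace • frameA j k =
      ((1 / 4 : ℂ) * X k j) • E j k + (-(1 / 4 : ℂ) * X k j) • E k j
        + (-(1 / 4 : ℂ) * X j k) • E j k + ((1 / 4 : ℂ) * X j k) • E k j := by
    intro j k
    rw [frameA, smul_mul_assoc, trace_smul, sub_mul, trace_sub, trace_E_mul, trace_E_mul,
      smul_smul, smul_eq_mul]
    module
  simp_rw [h, sum_add_distrib, sum_sum_smul_E, sum_sum_smul_E']
  ext a b
  simp only [Matrix.add_apply, Matrix.smul_apply, transpose_apply, of_apply, Matrix.sub_apply, smul_eq_mul]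
  ring

/-- `∑_{jk} tr(Y^{B,0}_{jk} X) Y^{B,0}_{jk} = -(Xᵀ + X)/2`. [folklore] -/
theorem sum_trace_mul_smul_frameB0 (X : Matrix (Fin N) (Fin N) ℂ) :
    ∑ j, ∑ k, (frameB0 j k * X).trace • frameB0 j k = -(1 / 2 : ℂ) • (Xᵀ + X) := by
  have h : ∀ j k, (frameB0 j k * X).trace • frameB0 j k =
      (-(1 / 4 : ℂ) * X k j) • E j k + (-(1 / 4 : ℂ) * X k j) • E k j
        + (-(1 / 4 : ℂ) * X j k) • E j k + (-(1 / 4 : ℂ) * X j k) • E k j := by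
    intro j k
    rw [frameB0, smul_mul_assoc, trace_smul, add_mul, trace_add, trace_E_mul, trace_E_mul,
      smul_smul, smul_eq_mul, I_half_mul_mul_I_half]
    module
  simp_rw [h, sum_add_distrib, sum_sum_smul_E, sum_sum_smul_E']
  ext a b
  simp only [Matrix.add_apply, Matrix.smul_apply, transpose_apply, of_apply, smul_eq_mul]
  ring

/-- `tr(Y^{B,0}_{jk} X) = (i/2)(X_{kj} + X_{jk})`. [folklore] -/
theorem trace_frameB0_mul (j k : Fin N) (X : Matrix (Fin N) (Fin N) ℂ) :
    (frameB0 j k * X).trace = (I / 2) * (X k j + X j k) := by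
  rw [frameB0, smul_mul_assoc, trace_smul, add_mul, trace_add, trace_E_mul, trace_E_mul, smul_eq_mul]

/-- `tr` of the central correction against `X`. [folklore] -/
theorem trace_frameC_mul (j k : Fin N) (X : Matrix (Fin N) (Fin N) ℂ) :
    (frameC j k * X).trace = if j = k then (I / N) * X.trace else 0 := by
  unfold frameC
  split_ifs
  · rw [smul_mul_assoc, one_mul, trace_smul, smul_eq_mul]
  · rw [zero_mul, trace_zero]

/-- Sums involving the central correction only see the diagonal. [folklore] -/
theorem sum_sum_frameC {M : Type*} [AddCommMonoid M]
    (f : Fin N → Fin N → Matrix (Fin N) (Fin N) ℂ → M) (hf : ∀ j k, f j k 0 = 0) :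
    ∑ j, ∑ k, f j k (frameC j k) = ∑ j, f j j ((I / N) • (1 : Matrix (Fin N) (Fin N) ℂ)) := by
  refine sum_congr rfl fun j _ => ?_
  rw [sum_eq_single j]
  · simp [frameC]
  · intro k _ hk
    rw [frameC, if_neg (Ne.symm hk), hf]
  · intro h; exact absurd (mem_univ j) h

/-- `∑_j Y^{B,0}_{jj} = i 1`. [folklore] -/
theorem sum_frameB0_diag : ∑ j : Fin N, frameB0 j j = I • (1 : Matrix (Fin N) (Fin N) ℂ) := by
  have : ∀ j : Fin N, frameB0 j j = I • E j j := by
    intro j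
    rw [frameB0, ← two_smul ℂ, smul_smul]
    congr 1
    ring
  simp_rw [this, ← smul_sum, sum_E_diag]

/-- `∑_j tr(Y^{B,0}_{jj} X) = i tr X`. [folklore] -/
theorem sum_trace_frameB0_diag_mul (X : Matrix (Fin N) (Fin N) ℂ) :
    ∑ j : Fin N, (frameB0 j j * X).trace = I * X.trace := by
  simp_rw [trace_frameB0_mul, ← mul_sum, sum_add_distrib]
  rw [Matrix.trace]
  simp only [diag_apply]
  ring

/-- `∑_{jk} tr(Y^B_{jk} X) Y^B_{jk} = -(Xᵀ + X)/2 + (tr X / N) 1`. [folklore] -/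
theorem sum_trace_mul_smul_frameB (hN : N ≠ 0) (X : Matrix (Fin N) (Fin N) ℂ) :
    ∑ j, ∑ k, (frameB j k * X).trace • frameB j k =
      -(1 / 2 : ℂ) • (Xᵀ + X) + (X.trace / N) • (1 : Matrix (Fin N) (Fin N) ℂ) := by
  have hN' : (N : ℂ) ≠ 0 := Nat.cast_ne_zero.2 hN
  -- expand `(b - c) ⊗ (b - c)`
  have h : ∀ j k, (frameB j k * X).trace • frameB j k =
      (frameB0 j k * X).trace • frameB0 j k - (frameB0 j k * X).trace • frameC j k
        - (frameC j k * X).trace • frameB0 j k + (frameC j k * X).trace • frameC j k := by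
    intro j k
    rw [frameB, sub_mul, trace_sub, sub_smul, smul_sub, smul_sub]
    abel
  simp_rw [h, sum_add_distrib, sum_sub_distrib, sum_trace_mul_smul_frameB0]
  -- the three correction sums
  have h1 : ∑ j, ∑ k, (frameB0 j k * X).trace • frameC j k = -(X.trace / N) • (1 : Matrix _ _ ℂ) := by
    rw [sum_sum_frameC (M := Matrix (Fin N) (Fin N) ℂ) (fun j k C => (frameB0 j k * X).trace • C)
      (fun j k => smul_zero _)]
    simp_rw [smul_smul, ← sum_smul, ← sum_mul, sum_trace_frameB0_diag_mul]
    congr 1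
    rw [show I * X.trace * (I / N) = (I * I) * X.trace / N by ring, I_mul_I]
    ring
  have h2 : ∑ j, ∑ k, (frameC j k * X).trace • frameB0 j k = -(X.trace / N) • (1 : Matrix _ _ ℂ) := by
    have : ∀ j k, (frameC j k * X).trace • frameB0 j k =
        (if j = k then ((I / N) * X.trace) • frameB0 j j else 0) := by
      intro j k
      rw [trace_frameC_mul]
      split_ifs with hjk
      · subst hjk; rfl
      · rw [zero_smul]
    simp_rw [this, sum_ite_eq, mem_univ, if_true, ← smul_sum, sum_frameB0_diag, smul_smul]
    congr 1
    rw [show I / N * X.trace * I = (I * I) * X.trace / N by ring, I_mul_I]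
    ring
  have h3 : ∑ j, ∑ k, (frameC j k * X).trace • frameC j k = -(X.trace / N) • (1 : Matrix _ _ ℂ) := by
    rw [sum_sum_frameC (M := Matrix (Fin N) (Fin N) ℂ) (fun j k C => (frameC j k * X).trace • C)
      (fun j k => smul_zero _)]
    simp_rw [trace_frameC_mul, if_true, smul_smul, ← sum_smul, sum_const, card_univ, Fintype.card_fin,
      nsmul_eq_mul]
    congr 1
    rw [show (N : ℂ) * (I / N * X.trace * (I / N)) = (I * I) * X.trace / N by field_simp, I_mul_I]
    ring
  rw [h1, h2, h3]
  module

/-- **Reconstruction**: `∑_α tr(Y_α X) Y_α = -X + (tr X / N) 1` for every complex matrix `X`; in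
particular `X = -∑_α tr(Y_α X) Y_α` for traceless `X` (the frame is a Parseval frame of
`𝔰𝔲(N)`). [folklore] -/
theorem sum_trace_mul_smul_frame (hN : N ≠ 0) (X : Matrix (Fin N) (Fin N) ℂ) :
    ∑ α, (frame α * X).trace • frame α = -X + (X.trace / N) • (1 : Matrix (Fin N) (Fin N) ℂ) := by
  rw [sum_frame (N := N) (fun Y => (Y * X).trace • Y), sum_trace_mul_smul_frameA,
    sum_trace_mul_smul_frameB hN]
  module

/-- Reconstruction of traceless matrices: `X = -∑_α tr(Y_α X) Y_α`. [folklore] -/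
theorem sum_trace_mul_smul_frame_of_trace_eq_zero (hN : N ≠ 0) {X : Matrix (Fin N) (Fin N) ℂ}
    (hX : X.trace = 0) : ∑ α, (frame α * X).trace • frame α = -X := by
  rw [sum_trace_mul_smul_frame hN, hX, zero_div, zero_smul, add_zero]

/-! ### The Casimir identity `∑_α Y_α X Y_α = -(tr X) 1 + X / N` -/

/-- `∑_{jk} Y^A X Y^A = (Xᵀ - tr X 1)/2`. [folklore] -/
theorem sum_frameA_mul_mul_frameA (X : Matrix (Fin N) (Fin N) ℂ) :
    ∑ j, ∑ k, frameA j k * X * frameA j k =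
      (1 / 2 : ℂ) • (Xᵀ - X.trace • (1 : Matrix (Fin N) (Fin N) ℂ)) := by
  have h : ∀ j k, frameA j k * X * frameA j k =
      ((1 / 4 : ℂ) * X k j) • E j k + (-(1 / 4 : ℂ) * X k k) • E j j
        + (-(1 / 4 : ℂ) * X j j) • E k k + ((1 / 4 : ℂ) * X j k) • E k j := by
    intro j k
    rw [frameA, smul_mul_assoc, smul_mul_assoc, mul_smul_comm, smul_smul]
    simp only [sub_mul, mul_sub, E_mul_mul_E]
    module
  simp_rw [h, sum_add_distrib, sum_sum_smul_E, sum_sum_smul_E', sum_sum_smul_E_diag_left,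
    sum_sum_smul_E_diag_right]
  ext a b
  simp only [Matrix.add_apply, Matrix.smul_apply, transpose_apply, of_apply, Matrix.sub_apply, one_apply,
    smul_eq_mul, Matrix.trace, diag_apply]
  split_ifs <;> ring

/-- `∑_{jk} Y^{B,0} X Y^{B,0} = -(Xᵀ + tr X 1)/2`. [folklore] -/
theorem sum_frameB0_mul_mul_frameB0 (X : Matrix (Fin N) (Fin N) ℂ) :
    ∑ j, ∑ k, frameB0 j k * X * frameB0 j k =
      -(1 / 2 : ℂ) • (Xᵀ + X.trace • (1 : Matrix (Fin N) (Fin N) ℂ)) := by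
  have h : ∀ j k, frameB0 j k * X * frameB0 j k =
      (-(1 / 4 : ℂ) * X k j) • E j k + (-(1 / 4 : ℂ) * X k k) • E j j
        + (-(1 / 4 : ℂ) * X j j) • E k k + (-(1 / 4 : ℂ) * X j k) • E k j := by
    intro j k
    rw [frameB0, smul_mul_assoc, smul_mul_assoc, mul_smul_comm, smul_smul,
      show I / 2 * (I / 2) = (I * I) / 4 by ring, I_mul_I]
    simp only [add_mul, mul_add, E_mul_mul_E]
    module
  simp_rw [h, sum_add_distrib, sum_sum_smul_E, sum_sum_smul_E', sum_sum_smul_E_diag_left,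
    sum_sum_smul_E_diag_right]
  ext a b
  simp only [Matrix.add_apply, Matrix.smul_apply, transpose_apply, of_apply, one_apply,
    smul_eq_mul, Matrix.trace, diag_apply]
  split_ifs <;> ring

/-- `∑_{jk} Y^B X Y^B = -(Xᵀ + tr X 1)/2 + X/N`. [folklore] -/
theorem sum_frameB_mul_mul_frameB (hN : N ≠ 0) (X : Matrix (Fin N) (Fin N) ℂ) :
    ∑ j, ∑ k, frameB j k * X * frameB j k =
      -(1 / 2 : ℂ) • (Xᵀ + X.trace • (1 : Matrix (Fin N) (Fin N) ℂ)) + (1 / N : ℂ) • X := by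
  have hN' : (N : ℂ) ≠ 0 := Nat.cast_ne_zero.2 hN
  have h : ∀ j k, frameB j k * X * frameB j k =
      frameB0 j k * X * frameB0 j k - frameB0 j k * X * frameC j k - frameC j k * X * frameB0 j k
        + frameC j k * X * frameC j k := by
    intro j k
    rw [frameB, sub_mul, sub_mul, mul_sub, mul_sub]
    abel
  simp_rw [h, sum_add_distrib, sum_sub_distrib, sum_frameB0_mul_mul_frameB0]
  have h1 : ∑ j, ∑ k, frameB0 j k * X * frameC j k = -(1 / N : ℂ) • X := by
    rw [sum_sum_frameC (M := Matrix (Fin N) (Fin N) ℂ) (fun j k C => frameB0 j k * X * C)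
      (fun j k => mul_zero _)]
    simp_rw [mul_smul_comm, mul_one, ← smul_sum, ← sum_mul, sum_frameB0_diag, smul_mul_assoc, one_mul,
      smul_smul]
    congr 1
    rw [show I / N * I = I * I / N by ring, I_mul_I]
    ring
  have h2 : ∑ j, ∑ k, frameC j k * X * frameB0 j k = -(1 / N : ℂ) • X := by
    have : ∀ j k, frameC j k * X * frameB0 j k =
        (if j = k then ((I / N) • (1 : Matrix _ _ ℂ)) * X * frameB0 j j else 0) := by
      intro j k
      unfold frameC
      split_ifs with hjk
      · subst hjk; rfl
      · rw [zero_mul, zero_mul]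
    simp_rw [this, sum_ite_eq, mem_univ, if_true, smul_mul_assoc, one_mul, ← smul_sum, ← mul_sum,
      sum_frameB0_diag, mul_smul_comm, mul_one, smul_smul]
    congr 1
    rw [show I / N * I = I * I / N by ring, I_mul_I]
    ring
  have h3 : ∑ j, ∑ k, frameC j k * X * frameC j k = -(1 / N : ℂ) • X := by
    rw [sum_sum_frameC (M := Matrix (Fin N) (Fin N) ℂ) (fun j k C => frameC j k * X * C)
      (fun j k => mul_zero _)]
    simp_rw [frameC, if_true, smul_mul_assoc, one_mul, mul_smul_comm, mul_one, smul_smul, sum_const,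
      card_univ, Fintype.card_fin, ← Nat.cast_smul_eq_nsmul ℂ, smul_smul]
    congr 1
    rw [show (N : ℂ) * (I / N * (I / N)) = (I * I) / N by field_simp, I_mul_I]
    ring
  rw [h1, h2, h3]
  module

/-- **Casimir identity** `∑_α Y_α X Y_α = -(tr X) 1 + X / N` for every complex matrix `X` (for
`X = 1`: `∑_α Y_α² = -(N - 1/N) 1`, the Casimir of the fundamental representation). [folklore] -/
theorem sum_frame_mul_mul_frame (hN : N ≠ 0) (X : Matrix (Fin N) (Fin N) ℂ) :
    ∑ α, frame α * X * frame α = -(X.trace • (1 : Matrix (Fin N) (Fin N) ℂ)) + (1 / N : ℂ) • X := by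
  rw [sum_frame (N := N) (fun Y => Y * X * Y), sum_frameA_mul_mul_frameA, sum_frameB_mul_mul_frameB hN]
  module

/-- `∑_α Y_α² = -(N - 1/N) 1`. [folklore] -/
theorem sum_frame_mul_frame (hN : N ≠ 0) :
    ∑ α, frame α * frame α = -(((N : ℂ) - 1 / N) • (1 : Matrix (Fin N) (Fin N) ℂ)) := by
  have := sum_frame_mul_mul_frame hN (1 : Matrix (Fin N) (Fin N) ℂ)
  simp_rw [mul_one] at this
  rw [this, trace_one, Fintype.card_fin]
  module

/-! ### Skew-Hermitian traceless matrices: real traces, reconstruction, Parseval, Killing -/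

/-- `(A B)ᴴ = B A` for skew-Hermitian `A, B`. [folklore] -/
theorem conjTranspose_mul_of_skew {A B : Matrix (Fin N) (Fin N) ℂ} (hA : Aᴴ = -A) (hB : Bᴴ = -B) :
    (A * B)ᴴ = B * A := by
  rw [conjTranspose_mul, hA, hB, neg_mul_neg]

/-- `tr(A B)` is real for skew-Hermitian `A, B`. [folklore] -/
theorem trace_mul_eq_re_of_skew {A B : Matrix (Fin N) (Fin N) ℂ} (hA : Aᴴ = -A) (hB : Bᴴ = -B) :
    (A * B).trace = (((A * B).trace.re : ℝ) : ℂ) := by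
  have h : conj ((A * B).trace) = (A * B).trace := by
    have h1 := trace_conjTranspose (A * B)
    rw [conjTranspose_mul_of_skew hA hB, trace_mul_comm] at h1
    rw [Complex.star_def] at h1
    exact h1.symm
  exact (Complex.conj_eq_iff_re.1 h).symm

/-- A commutator of skew-Hermitian matrices is skew-Hermitian. [folklore] -/
theorem conjTranspose_comm_of_skew {A B : Matrix (Fin N) (Fin N) ℂ} (hA : Aᴴ = -A) (hB : Bᴴ = -B) :
    (A * B - B * A)ᴴ = -(A * B - B * A) := by
  rw [conjTranspose_sub, conjTranspose_mul_of_skew hA hB, conjTranspose_mul_of_skew hB hA, neg_sub]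

/-- A commutator is traceless. [folklore] -/
theorem trace_comm (A B : Matrix (Fin N) (Fin N) ℂ) : (A * B - B * A).trace = 0 := by
  rw [trace_sub, trace_mul_comm, sub_self]

/-- `‖A‖_F² = -Re tr(A A)` for skew-Hermitian `A`. [folklore] -/
theorem frobNorm_sq_of_skew {A : Matrix (Fin N) (Fin N) ℂ} (hA : Aᴴ = -A) :
    frobNorm A ^ 2 = -(A * A).trace.re := by
  rw [frobNorm_sq_eq_re_trace, hA, neg_mul, trace_neg, Complex.neg_re]

/-- A real combination of frame directions is skew-Hermitian. [folklore] -/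
theorem conjTranspose_sum_smul_frame (a : FrameIdx N → ℝ) :
    (∑ α, a α • frame α)ᴴ = -∑ α, a α • frame α := by
  rw [conjTranspose_sum, ← sum_neg_distrib]
  refine sum_congr rfl fun α _ => ?_
  rw [conjTranspose_smul, frame_conjTranspose, smul_neg, star_trivial]

/-- A real combination of frame directions is traceless. [folklore] -/
theorem trace_sum_smul_frame (hN : N ≠ 0) (a : FrameIdx N → ℝ) : (∑ α, a α • frame α).trace = 0 := by
  rw [trace_sum]
  exact sum_eq_zero fun α _ => by rw [trace_smul, frame_trace hN, smul_zero]

/-- **Reconstruction with real coefficients**: `X = ∑_α ⟨Y_α, X⟩ Y_α` for `X ∈ 𝔰𝔲(N)`, where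
`⟨Y, X⟩ = Re tr(Yᴴ X) = -Re tr(Y X)`. [folklore] -/
theorem sum_re_trace_smul_frame (hN : N ≠ 0) {X : Matrix (Fin N) (Fin N) ℂ} (hX : Xᴴ = -X)
    (hX0 : X.trace = 0) : ∑ α, (-(frame α * X).trace.re) • frame α = X := by
  have h := sum_trace_mul_smul_frame_of_trace_eq_zero hN hX0
  have h' : ∑ α, (frame α * X).trace • frame α = ∑ α, ((frame α * X).trace.re) • frame α := by
    refine sum_congr rfl fun α _ => ?_
    rw [trace_mul_eq_re_of_skew (frame_conjTranspose α) hX, Complex.ofReal_re, Complex.coe_smul]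
  calc ∑ α, (-(frame α * X).trace.re) • frame α = -∑ α, ((frame α * X).trace.re) • frame α := by
        rw [← sum_neg_distrib]
        exact sum_congr rfl fun α _ => neg_smul _ _
    _ = X := by rw [← h', h, neg_neg]

/-- **Parseval**: `∑_α ⟨Y_α, X⟩² = ‖X‖_F²` for `X ∈ 𝔰𝔲(N)`. [folklore] -/
theorem sum_sq_re_trace_frame_mul (hN : N ≠ 0) {X : Matrix (Fin N) (Fin N) ℂ} (hX : Xᴴ = -X)
    (hX0 : X.trace = 0) : ∑ α, ((frame α * X).trace.re) ^ 2 = frobNorm X ^ 2 := by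
  -- complex identity `∑ tr(Y_α X)² = tr((∑ tr(Y_α X) Y_α) X) = -tr(X X)`
  have hc : ∑ α, (frame α * X).trace * (frame α * X).trace = -(X * X).trace := by
    have h := congrArg (fun M => (M * X).trace) (sum_trace_mul_smul_frame_of_trace_eq_zero hN hX0)
    simp only [sum_mul, trace_sum, smul_mul_assoc, trace_smul, smul_eq_mul, neg_mul, trace_neg] at h
    exact h
  have hre : ∀ α : FrameIdx N, (frame α * X).trace = (((frame α * X).trace.re : ℝ) : ℂ) := fun α =>
    trace_mul_eq_re_of_skew (frame_conjTranspose α) hX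
  have hc' : ((∑ α, ((frame α * X).trace.re) ^ 2 : ℝ) : ℂ) = -(X * X).trace := by
    rw [← hc, Complex.ofReal_sum]
    refine sum_congr rfl fun α _ => ?_
    rw [Complex.ofReal_pow, ← hre, sq]
  rw [frobNorm_sq_of_skew hX, ← Complex.neg_re, ← hc', Complex.ofReal_re]

/-- **Killing form of `𝔰𝔲(N)`** (`Ric = N/2` for the Hilbert–Schmidt metric, Shen–Zhu–Zhu (4.8)
with `α = 2`, after [AGZ10, (F.6)]):
`∑_α ‖[Z, Y_α]‖_F² = 2N ‖Z‖_F²` for `Z ∈ 𝔰𝔲(N)`. [cite: arXiv220412737, (4.8) (p. 19)] -/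
theorem sum_frobNorm_sq_comm_frame (hN : N ≠ 0) {Z : Matrix (Fin N) (Fin N) ℂ} (hZ : Zᴴ = -Z)
    (hZ0 : Z.trace = 0) :
    ∑ α, frobNorm (Z * frame α - frame α * Z) ^ 2 = 2 * N * frobNorm Z ^ 2 := by
  have hN' : (N : ℂ) ≠ 0 := Nat.cast_ne_zero.2 hN
  -- `tr(W_α W_α) = 2 tr(Z Y Z Y) - 2 tr(Z Z Y Y)`
  have hW : ∀ α : FrameIdx N, ((Z * frame α - frame α * Z) * (Z * frame α - frame α * Z)).trace =
      2 * (Z * (frame α * Z * frame α)).trace - 2 * (Z * Z * (frame α * frame α)).trace := by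
    intro α
    set Y := frame α
    have t1 : (Z * Y * (Z * Y)).trace = (Z * (Y * (Z * Y))).trace := by simp only [Matrix.mul_assoc]
    have t2 : (Z * Y * (Y * Z)).trace = (Z * (Z * (Y * Y))).trace := by
      rw [trace_mul_comm, Matrix.mul_assoc, trace_mul_comm]; simp only [Matrix.mul_assoc]
    have t3 : (Y * Z * (Z * Y)).trace = (Z * (Z * (Y * Y))).trace := by
      rw [Matrix.mul_assoc, trace_mul_comm]; simp only [Matrix.mul_assoc]
    have t4 : (Y * Z * (Y * Z)).trace = (Z * (Y * (Z * Y))).trace := by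
      rw [← Matrix.mul_assoc, trace_mul_comm]; simp only [Matrix.mul_assoc]
    simp only [sub_mul, mul_sub, trace_sub, t1, t2, t3, t4]
    simp only [Matrix.mul_assoc]
    ring
  -- sum over the frame, using the two Casimir identities
  have hA : ∑ α, (Z * (frame α * Z * frame α)).trace = (1 / N : ℂ) * (Z * Z).trace := by
    rw [← trace_sum, ← Matrix.mul_sum, sum_frame_mul_mul_frame hN, hZ0, zero_smul, neg_zero, zero_add,
      Matrix.mul_smul, trace_smul, smul_eq_mul]
  have hB : ∑ α, (Z * Z * (frame α * frame α)).trace = -((N : ℂ) - 1 / N) * (Z * Z).trace := by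
    rw [← trace_sum, ← Matrix.mul_sum, sum_frame_mul_frame hN, Matrix.mul_neg, Matrix.mul_smul,
      Matrix.mul_one, trace_neg, trace_smul, smul_eq_mul, neg_mul]
  have hsum : ∑ α, ((Z * frame α - frame α * Z) * (Z * frame α - frame α * Z)).trace =
      2 * N * (Z * Z).trace := by
    simp_rw [hW]
    rw [sum_sub_distrib, ← mul_sum, ← mul_sum, hA, hB]
    field_simp
    ring
  -- real parts
  have hskew : ∀ α : FrameIdx N, (Z * frame α - frame α * Z)ᴴ = -(Z * frame α - frame α * Z) := fun α =>
    conjTranspose_comm_of_skew hZ (frame_conjTranspose α)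
  simp_rw [frobNorm_sq_of_skew (hskew _), frobNorm_sq_of_skew hZ, sum_neg_distrib, ← Complex.re_sum, hsum]
  have : (2 * (N : ℂ) * (Z * Z).trace).re = 2 * N * (Z * Z).trace.re := by
    rw [show (2 * (N : ℂ)) = ((2 * N : ℝ) : ℂ) by push_cast; ring, Complex.re_ofReal_mul]
  rw [this]
  ring

/-! ### Linear functionals on the frame -/

/-- The `𝔰𝔲(N)`-gradient of a real linear functional: `Z_λ = ∑_α λ(Y_α) Y_α`. [folklore] -/
def frameGrad (lam : Matrix (Fin N) (Fin N) ℂ →ₗ[ℝ] ℝ) : Matrix (Fin N) (Fin N) ℂ :=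
  ∑ α, lam (frame α) • frame α

/-- `Z_λ` is skew-Hermitian. [folklore] -/
theorem frameGrad_conjTranspose (lam : Matrix (Fin N) (Fin N) ℂ →ₗ[ℝ] ℝ) :
    (frameGrad lam)ᴴ = -frameGrad lam :=
  conjTranspose_sum_smul_frame _

/-- `Z_λ` is traceless. [folklore] -/
theorem frameGrad_trace (hN : N ≠ 0) (lam : Matrix (Fin N) (Fin N) ℂ →ₗ[ℝ] ℝ) :
    (frameGrad lam).trace = 0 :=
  trace_sum_smul_frame hN _

/-- **Riesz representation on `𝔰𝔲(N)`**: `λ(X) = ⟨Z_λ, X⟩ = -Re tr(X Z_λ)` for `X ∈ 𝔰𝔲(N)`. [folklore] -/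
theorem apply_eq_neg_re_trace_mul_frameGrad (hN : N ≠ 0) (lam : Matrix (Fin N) (Fin N) ℂ →ₗ[ℝ] ℝ)
    {X : Matrix (Fin N) (Fin N) ℂ} (hX : Xᴴ = -X) (hX0 : X.trace = 0) :
    lam X = -(X * frameGrad lam).trace.re := by
  conv_lhs => rw [← sum_re_trace_smul_frame hN hX hX0]
  rw [map_sum, frameGrad, Matrix.mul_sum, trace_sum, Complex.re_sum, ← sum_neg_distrib]
  refine sum_congr rfl fun α _ => ?_
  rw [map_smul, smul_eq_mul, Matrix.mul_smul, trace_smul, Complex.smul_re, smul_eq_mul,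
    trace_mul_comm]
  ring

/-- `∑_α λ(Y_α)² = λ(Z_λ)`. [folklore] -/
theorem sum_sq_apply_frame (lam : Matrix (Fin N) (Fin N) ℂ →ₗ[ℝ] ℝ) :
    ∑ α, lam (frame α) ^ 2 = lam (frameGrad lam) := by
  rw [frameGrad, map_sum]
  refine sum_congr rfl fun α _ => ?_
  rw [map_smul, smul_eq_mul, sq]

/-- **Parseval for functionals**: `‖Z_λ‖_F² = ∑_α λ(Y_α)²`. [folklore] -/
theorem frobNorm_frameGrad_sq (hN : N ≠ 0) (lam : Matrix (Fin N) (Fin N) ℂ →ₗ[ℝ] ℝ) :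
    frobNorm (frameGrad lam) ^ 2 = ∑ α, lam (frame α) ^ 2 := by
  rw [sum_sq_apply_frame, frobNorm_sq_of_skew (frameGrad_conjTranspose lam),
    apply_eq_neg_re_trace_mul_frameGrad hN lam (frameGrad_conjTranspose lam) (frameGrad_trace hN lam)]

/-- **The frame trick**: if `|λ(A)| ≤ M ‖A‖_F` for all `A`, then `∑_α λ(Y_α)² ≤ M²` (the restriction
of `λ` to `𝔰𝔲(N)` has norm `≤ M`, computed in the Parseval frame). [folklore] -/
theorem sum_sq_apply_frame_le (hN : N ≠ 0) (lam : Matrix (Fin N) (Fin N) ℂ →ₗ[ℝ] ℝ) {M : ℝ}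
    (h : ∀ A, |lam A| ≤ M * frobNorm A) : ∑ α, lam (frame α) ^ 2 ≤ M ^ 2 := by
  set s := ∑ α, lam (frame α) ^ 2 with hs
  have hs0 : 0 ≤ s := sum_nonneg fun α _ => sq_nonneg _
  have h1 : s ≤ M * Real.sqrt s := by
    calc s = lam (frameGrad lam) := sum_sq_apply_frame lam
      _ ≤ |lam (frameGrad lam)| := le_abs_self _
      _ ≤ M * frobNorm (frameGrad lam) := h _
      _ = M * Real.sqrt s := by
          rw [← Real.sqrt_sq (frobNorm_nonneg (frameGrad lam)), frobNorm_frameGrad_sq hN]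
  -- `s ≤ M √s ⇒ s ≤ M²`
  have h2 : Real.sqrt s * Real.sqrt s ≤ M * Real.sqrt s := by rwa [Real.mul_self_sqrt hs0]
  by_cases hs1 : Real.sqrt s = 0
  · have : s = 0 := by rwa [Real.sqrt_eq_zero hs0] at hs1
    rw [this]; positivity
  · have hpos : 0 < Real.sqrt s := lt_of_le_of_ne (Real.sqrt_nonneg s) (Ne.symm hs1)
    have h3 : Real.sqrt s ≤ M := le_of_mul_le_mul_right h2 hpos
    calc s = Real.sqrt s ^ 2 := (Real.sq_sqrt hs0).symm
      _ ≤ M ^ 2 := pow_le_pow_left₀ (Real.sqrt_nonneg s) h3 2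

/-! ### Bilinear expansions -/

/-- `∑_{αβ} a_α a_β Re tr(P Y_α Y_β R) = Re tr(P Z Z R)` with `Z = ∑ a_α Y_α`. [folklore] -/
theorem sum_sum_mul_mul_re_trace (a : FrameIdx N → ℝ) (P R : Matrix (Fin N) (Fin N) ℂ) :
    ∑ α, ∑ β, a α * a β * (P * frame α * frame β * R).trace.re =
      (P * (∑ α, a α • frame α) * (∑ α, a α • frame α) * R).trace.re := by
  simp only [Matrix.sum_mul, Matrix.mul_smul, Matrix.smul_mul, trace_sum, trace_smul,
    Complex.re_sum, Complex.smul_re, smul_eq_mul, Finset.mul_sum]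
  rw [sum_comm]
  refine sum_congr rfl fun α _ => sum_congr rfl fun β _ => ?_
  ring

end SUNBakryEmery

end Literature.MathematicalPhysics.QuantumFieldTheory
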